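import Summits.BirchSwinnertonDyer.BirchSwinnertonDyer.Theses.KolyvaginRankRigidityAtTwo
import HarnessLib

/-!
# Crux V2 `KolyvaginCorankRigidityAtTwo` (stmt-BirchSwinnertonDyer-23949): the deciding theorem
# consumes ONLY the lower-bound half (lead prover bsd-line-krr2-p1, 2026-08-28)

Kernel-checked bookkeeping for the planner (no mathematics beyond `omega`):

* `DepthLowerBoundAtTwo` — V2 with its dichotomy
  `(c = ν+1 ∧ c' ≤ ν) ∨ (c' = ν+1 ∧ c ≤ ν)` replaced by the LOWER BOUND `ν+1 ≤ c ∨ ν+1 ≤ c'`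
  (same binders, same habitat, same minimality clause; `c = corank Sel_{2^∞}(E/ℚ)`,
  `c' = corank Sel_{2^∞}(E^{(d_K)}/ℚ)`, `ν = #(ℓ ∣ n)`). This is the direction of Kolyvagin 1991
  (Math. Ann. 291) Thm. 2.2 / W. Zhang 2014 Lemma 8.4 (independent classes at minimal depth); the
  dropped half `max(c,c') ≤ ν+1 ∧ min(c,c') ≤ ν` is Kolyvagin's DESCENT (Thm. 2.1/2.3), the part of
  V2 whose port to `p = 2` nobody has in print.
* `depthLowerBoundAtTwo_of_corankRigidity` — V2 ⇒ the weakening (so it is a weakening).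
* `closes_of_depthLowerBound` — the route's deciding theorem `closes` VERBATIM with `hV2` weakened
  to `DepthLowerBoundAtTwo`: the leaf `Rank1Residual.NonCMTwoConverse` still follows from the other
  nine items. Hence the upper-bound half of V2 is idle in this route (and in
  `TwoAdicConverse.RankOneTwoConverseGlue`, whose use of V2 is the same two lines).

Nothing here proves V2, its weakening, or BSD.
-/

set_option autoImplicit false
set_option linter.dupNamespace false

noncomputable section

open scoped Classical

open WeierstrassCurve Literature.NumberTheory.EllipticCurves
  Literature.NumberTheory.EllipticCurves.ModularForms
open Summit.BirchSwinnertonDyer.BirchSwinnertonDyer.Theses.KolyvaginRankRigidityAtTwo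

namespace Summit.BirchSwinnertonDyer.BirchSwinnertonDyer.Cruxes.KolyvaginCorankRigidityAtTwo.Weakening

/-- **V2♭ — the lower-bound half of V2.** Same habitat and binders as
`KolyvaginCorankRigidityAtTwo`; conclusion weakened to `ν + 1 ≤ c ∨ ν + 1 ≤ c'`: a non-zero
Kolyvagin class at `2` of minimal depth `ν` forces one of the two `2^∞`-Selmer coranks to be at
least `ν + 1` (Kolyvagin 1991 Thm. 2.2 / Zhang 2014 Lemma 8.4 direction, asked at `p = 2`). -/
def DepthLowerBoundAtTwo : Prop :=
  ∀ (W : WeierstrassCurve ℚ) [W.IsElliptic] [W.IsGloballyMinimal], ¬ W.HasCM →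
    (Rank1Residual.GoodOrd W 2 ∨ Rank1Residual.Mult W 2) →
    (∀ m : ℕ, W.HasSurjectiveModNGaloisRep (2 ^ m : ℕ)) →
    ∀ (K : Type) [Field K] [NumberField K], IsImaginaryQuadratic K → NumberField.discr K ≠ -3 →
    NumberField.discr K ≠ -4 → ¬ ((2 : ℤ) ∣ NumberField.discr K) → ∀ [NeZero (W.conductorNorm ℤ)],
    SatisfiesHeegnerHypothesis (W.conductorNorm ℤ) K →
    ∀ (Dt : ModularParametrizationData W (W.conductorNorm ℤ)) (β : ℤ) (ι : K →+* ℂ) (n : ℕ)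
      (d : KolyvaginHeegnerData Dt β ι n) (M : ℕ),
      KolyvaginDescent.KolSupp (Zhang2014.IsKolyvaginPrime (W.conductorNorm ℤ) W K 2) n →
      1 ≤ M → (M : ℕ∞) ≤ Zhang2014.levelIndex W 2 n → d.kolyvaginClass Nat.prime_two M ≠ 0 →
      (∀ (n' : ℕ) (d' : KolyvaginHeegnerData Dt β ι n') (M' : ℕ),
        KolyvaginDescent.KolSupp (Zhang2014.IsKolyvaginPrime (W.conductorNorm ℤ) W K 2) n' →
        1 ≤ M' → (M' : ℕ∞) ≤ Zhang2014.levelIndex W 2 n' → d'.kolyvaginClass Nat.prime_two M' ≠ 0 →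
        n.primeFactors.card ≤ n'.primeFactors.card) →
      (n.primeFactors.card + 1 ≤ W.selmerCorank 2 ∨
        n.primeFactors.card + 1 ≤ (W.quadraticTwist (NumberField.discr K : ℚ)).selmerCorank 2)

/-- V2 implies its lower-bound half (`omega` on the dichotomy). -/
theorem depthLowerBoundAtTwo_of_corankRigidity (hV2 : KolyvaginCorankRigidityAtTwo) :
    DepthLowerBoundAtTwo := by
  intro W _ _ hCM hred hsur K _ _ hK hne3 hne4 h2d _ hHN Dt β ι n d M hn hM1 hMle hne hmin
  have h := hV2 W hCM hred hsur K hK hne3 hne4 h2d hHN Dt β ι n d M hn hM1 hMle hne hmin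
  rcases h with ⟨h1, -⟩ | ⟨h1, -⟩ <;> omega

/-- **The route's deciding theorem with V2 weakened to its lower-bound half.** This is the body of
`Theses.KolyvaginRankRigidityAtTwo.closes` verbatim, except that the two lines consuming `hV2`
now consume `DepthLowerBoundAtTwo`; everything elaborates unchanged, so the clauses
`max(c,c') = ν+1`, `min(c,c') ≤ ν` of V2 are idle for the leaf. -/
theorem closes_of_depthLowerBound (hV1 : KolyvaginNonvanishingAtTwo) (hV2 : DepthLowerBoundAtTwo)
    (hR : OffHabitatNonSurjTwoConverse) (hIn : PrintedInputsRankOneAtTwo) (hT : NoTwoTorsionOverK)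
    (hBFH : SimpleZeroTwistSplitAtTwo) (hGZK : MultPublishedInputsAtTwo)
    (hMod : NewformOfEllipticCurve) (hHLT : HoffsteinLuoNonvanishingTwist) (hEnt : EntireLFunctionRat) :
    Summit.BirchSwinnertonDyer.BirchSwinnertonDyer.Rank1Residual.NonCMTwoConverse := by
  intro W _ _ hCM hred r hr hc
  by_cases hsur : (∀ m : ℕ, W.HasSurjectiveModNGaloisRep (2 ^ m : ℕ))
  swap
  · exact hR W hCM hred r hr hc hsur
  obtain ⟨-, -, hpar, hKato, -, hGZ, hrec⟩ := hIn
  have hmod : Literature.NumberTheory.EllipticCurves.ModularForms.exists_isNewformOf := hMod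
  have hHL : Literature.NumberTheory.EllipticCurves.HoffsteinLuo1997_exists_twist_L_one_ne_zero := hHLT
  have hE : WeierstrassCurve.hasEntireLFunction_rat := hEnt
  have hGZK' : Literature.NumberTheory.EllipticCurves.rank_eq_analyticRank_of_analyticRank_le_one := hGZK
  haveI : Fact (Nat.Prime 2) := ⟨Nat.prime_two⟩
  haveI : NeZero (W.conductorNorm ℤ) := ⟨(W.conductorNorm_pos_holds).ne'⟩
  obtain rfl | rfl : r = 0 ∨ r = 1 := by omega
  · -- ===== r = 0 : partner twist with a simple zero (BFH 1990 (i), `2` split) =====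
    have hw : W.rootNumber = 1 := by
      have h := hpar W
      unfold Literature.NumberTheory.EllipticCurves.p_parity at h
      rw [hc, pow_zero] at h
      exact h.symm
    obtain ⟨K, _, _, hK, -, hHN, hH2, hd8, hL0, hL1⟩ := hBFH W hw 0
    have hodd : Odd (NumberField.discr K) := by
      rw [Int.odd_iff]; omega
    have hne3 : NumberField.discr K ≠ -3 := by omega
    have hne4 : NumberField.discr K ≠ -4 := by omega
    have h2d : ¬ ((2 : ℤ) ∣ NumberField.discr K) := by omega
    have hd : (NumberField.discr K : ℚ) ≠ 0 := by exact_mod_cast NumberField.discr_ne_zero K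
    haveI := W.isElliptic_quadraticTwist hd
    have hr1 : (W.quadraticTwist (NumberField.discr K : ℚ)).analyticRank = 1 :=
      Literature.NumberTheory.EllipticCurves.analyticRank_eq_one_of_entireLFunction_one_eq_zero_of_deriv_ne_zero
        _ (hE _) hL0 hL1
    obtain ⟨hrk, hsha⟩ := hGZK' (W.quadraticTwist (NumberField.discr K : ℚ)) (le_of_eq hr1)
    rw [hr1] at hrk
    haveI := hsha
    have hc' : (W.quadraticTwist (NumberField.discr K : ℚ)).selmerCorank 2 = 1 :=
      Literature.NumberTheory.EllipticCurves.selmerCorank_eq_one_of_mordellWeilRank_eq_one_of_finite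
        (W.quadraticTwist (NumberField.discr K : ℚ)) 2 hrk inferInstance
    have htor := hT W hsur K hK
    obtain ⟨Dt, β, ι, n, d, M, hn, hM1, hMle, hne⟩ := hV1 W hCM hred hsur K hK hHN hodd hne3 htor hH2
    obtain ⟨n₀, d₀, M₀, hn₀, hM₀, hM₀le, hne₀, hmin⟩ :=
      Literature.NumberTheory.EllipticCurves.heegnerSystem_exists_minimal_kolyvaginClass_ne_zero
        Nat.prime_two d hn hM1 hMle hne
    -- the ONLY use of V2 (weakened): the lower bound `ν + 1 ≤ max(c, c') = 1` forces `ν = 0`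
    have hstruct := hV2 W hCM hred hsur K hK hne3 hne4 h2d hHN Dt β ι n₀ d₀ M₀ hn₀ hM₀ hM₀le hne₀ hmin
    have hν : n₀.primeFactors.card = 0 := by
      rcases hstruct with h1 | h1 <;> omega
    have hn1 : n₀ = 1 := by
      rw [Finset.card_eq_zero, Nat.primeFactors_eq_empty] at hν
      rcases hν with h0 | h1
      · exact absurd (h0 ▸ hn₀.1) not_squarefree_zero
      · exact h1
    subst hn1
    have hEK : Literature.NumberTheory.EllipticCurves.analyticRankEK W K = 1 :=
      Literature.NumberTheory.EllipticCurves.heegnerSystem_analyticRankEK_eq_one_of_kolyvaginClass_one_ne_zero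
        (hGZ W _ K) (hrec _ W K) hK rfl hHN d₀ hne₀
    rw [Literature.NumberTheory.EllipticCurves.analyticRankEK_eq_add_of hE W K, hr1] at hEK
    omega
  · -- ===== r = 1 : partner twist with L(E^{(d_K)}, 1) ≠ 0 (Hoffstein–Luo) =====
    have hw : W.rootNumber = -1 := by
      have h := hpar W
      unfold Literature.NumberTheory.EllipticCurves.p_parity at h
      rw [hc, pow_one] at h
      exact h.symm
    obtain ⟨K, _, _, hK, -, hHN, hH2, hd8, hL1⟩ :=
      Literature.NumberTheory.EllipticCurves.exists_heegnerField_split_twist_ne_zero_discr_emod_eight_of_hoffsteinLuo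
        hmod hHL W hw Nat.prime_two 0
    have hodd : Odd (NumberField.discr K) := by
      rw [Int.odd_iff]; omega
    have hne3 : NumberField.discr K ≠ -3 := by omega
    have hne4 : NumberField.discr K ≠ -4 := by omega
    have h2d : ¬ ((2 : ℤ) ∣ NumberField.discr K) := by omega
    have hd : (NumberField.discr K : ℚ) ≠ 0 := by exact_mod_cast NumberField.discr_ne_zero K
    haveI := W.isElliptic_quadraticTwist hd
    obtain ⟨-, -, hfin⟩ := hKato (W.quadraticTwist (NumberField.discr K : ℚ)) hL1
    haveI := hfin
    have hc' : (W.quadraticTwist (NumberField.discr K : ℚ)).selmerCorank 2 = 0 :=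
      (W.quadraticTwist (NumberField.discr K : ℚ)).selmerCorank_eq_zero_of_finite 2
    have htor := hT W hsur K hK
    obtain ⟨Dt, β, ι, n, d, M, hn, hM1, hMle, hne⟩ := hV1 W hCM hred hsur K hK hHN hodd hne3 htor hH2
    obtain ⟨n₀, d₀, M₀, hn₀, hM₀, hM₀le, hne₀, hmin⟩ :=
      Literature.NumberTheory.EllipticCurves.heegnerSystem_exists_minimal_kolyvaginClass_ne_zero
        Nat.prime_two d hn hM1 hMle hne
    -- the ONLY use of V2 (weakened): the lower bound `ν + 1 ≤ max(c, c') = 1` forces `ν = 0`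
    have hstruct := hV2 W hCM hred hsur K hK hne3 hne4 h2d hHN Dt β ι n₀ d₀ M₀ hn₀ hM₀ hM₀le hne₀ hmin
    have hν : n₀.primeFactors.card = 0 := by
      rcases hstruct with h1 | h1 <;> omega
    have hn1 : n₀ = 1 := by
      rw [Finset.card_eq_zero, Nat.primeFactors_eq_empty] at hν
      rcases hν with h0 | h1
      · exact absurd (h0 ▸ hn₀.1) not_squarefree_zero
      · exact h1
    subst hn1
    have hEK : Literature.NumberTheory.EllipticCurves.analyticRankEK W K = 1 :=
      Literature.NumberTheory.EllipticCurves.heegnerSystem_analyticRankEK_eq_one_of_kolyvaginClass_one_ne_zero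
        (hGZ W _ K) (hrec _ W K) hK rfl hHN d₀ hne₀
    rw [Literature.NumberTheory.EllipticCurves.analyticRankEK_eq_add_of hE W K,
      Literature.NumberTheory.EllipticCurves.analyticRank_eq_zero_of_entireLFunction_one_ne_zero _ hL1,
      add_zero] at hEK
    exact hEK

/-- **Even less is consumed:** `closes` applies V2 only at coranks `(c, c') ∈ {(0,1), (1,0)}`, where
the lower bound reads «a non-zero class of minimal depth has depth `0`», i.e. «corank-sum `1` and a
non-zero Kolyvagin system at `2` force `c_M(1) ≠ 0` for some `M`» (then `y_K` is non-torsion). This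
records that special case as a `Prop` for the planner's restatement; it follows from
`DepthLowerBoundAtTwo` by `omega`. -/
def DepthZeroOfCorankSumOneAtTwo : Prop :=
  ∀ (W : WeierstrassCurve ℚ) [W.IsElliptic] [W.IsGloballyMinimal], ¬ W.HasCM →
    (Rank1Residual.GoodOrd W 2 ∨ Rank1Residual.Mult W 2) →
    (∀ m : ℕ, W.HasSurjectiveModNGaloisRep (2 ^ m : ℕ)) →
    ∀ (K : Type) [Field K] [NumberField K], IsImaginaryQuadratic K → NumberField.discr K ≠ -3 →
    NumberField.discr K ≠ -4 → ¬ ((2 : ℤ) ∣ NumberField.discr K) → ∀ [NeZero (W.conductorNorm ℤ)],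
    SatisfiesHeegnerHypothesis (W.conductorNorm ℤ) K →
    W.selmerCorank 2 + (W.quadraticTwist (NumberField.discr K : ℚ)).selmerCorank 2 = 1 →
    ∀ (Dt : ModularParametrizationData W (W.conductorNorm ℤ)) (β : ℤ) (ι : K →+* ℂ) (n : ℕ)
      (d : KolyvaginHeegnerData Dt β ι n) (M : ℕ),
      KolyvaginDescent.KolSupp (Zhang2014.IsKolyvaginPrime (W.conductorNorm ℤ) W K 2) n →
      1 ≤ M → (M : ℕ∞) ≤ Zhang2014.levelIndex W 2 n → d.kolyvaginClass Nat.prime_two M ≠ 0 →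
      (∀ (n' : ℕ) (d' : KolyvaginHeegnerData Dt β ι n') (M' : ℕ),
        KolyvaginDescent.KolSupp (Zhang2014.IsKolyvaginPrime (W.conductorNorm ℤ) W K 2) n' →
        1 ≤ M' → (M' : ℕ∞) ≤ Zhang2014.levelIndex W 2 n' → d'.kolyvaginClass Nat.prime_two M' ≠ 0 →
        n.primeFactors.card ≤ n'.primeFactors.card) →
      n.primeFactors.card = 0

/-- The corank-sum-one special case follows from the lower bound. -/
theorem depthZeroOfCorankSumOne_of_depthLowerBound (h : DepthLowerBoundAtTwo) :
    DepthZeroOfCorankSumOneAtTwo := by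
  intro W _ _ hCM hred hsur K _ _ hK hne3 hne4 h2d _ hHN hsum Dt β ι n d M hn hM1 hMle hne hmin
  have h' := h W hCM hred hsur K hK hne3 hne4 h2d hHN Dt β ι n d M hn hM1 hMle hne hmin
  rcases h' with h1 | h1 <;> omega

end Summit.BirchSwinnertonDyer.BirchSwinnertonDyer.Cruxes.KolyvaginCorankRigidityAtTwo.Weakening

end
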